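import Summits.Ventures.Crystal3D.Theorems.StickyWulffConstantGenericWallFloorTubeLemma
import Summits.Ventures.Crystal3D.Theorems.StickyWulffConstantGenericWallFloorConeCertificateDefs
import Summits.Ventures.Crystal3D.Theorems.StickyWulffConstantGenericWallFloorConeCertificateFrame
import HarnessLib

/-!
# Cone certificates (3/3): the BRIDGE — a checked `ConeCert` gives the margin hypothesis of `eq_of_coneMargin`

Helper for `stmt-Ventures-19480` (E1 inside-tube step).  `ConeCert.margin`: if `C.check = true`
then for every tangent field `v` at the slot configuration `C.s` and every free ball `i₀` some active
contact functional is `≥ κ₀ ‖v i₀‖`, `κ₀ = C.kappa = kapNum/kapDen` (proof: `v i₀` lies in the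
tangent plane spanned by the integer frame `τ₀, τ₁`; by `exists_dir_of_frame` some signed
`⟨v i₀, ±τ_a⟩ ≥ ‖v i₀‖ ‖τ_a‖/√2`; the certificate's per-ball identity gives
`Σ_c λ_c L_c(v) = r ⟨v i₀, ±τ_a⟩/√N`, averaging (`exists_le_of_sum_eq`) a contact with
`L_c(v) ≥ that/Λ`, and the checked inequality `kapNum² Λ² 2N ≤ r² |τ_a|² kapDen²` converts to `κ₀`).
GLUE: `ConeCert.eq_slots` / `eq_slots_sharp` (every admissible completion within chord `κ₀/3`,
resp. `3κ₀/5`, of the slots IS the slot configuration) and the same in the distance vocabulary of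
`IsKissingAround` / `ExactOnly` (`eq_slots_dist`, `eq_slots_dist_sharp`, `norm_own`,
`s_mem_scaledPattern`, `ownSet_subset_scaledPattern`).

lit g11 (crystal3d-full; HOME/cf-lit/lean/conecert/, evidence #55 on stmt-Ventures-19480), landed verbatim
(split in three files for the 400-line rule) by prover 19480-p2.  Data: `…ConeCertData*.lean` (kit j291074/j291568,
`cert/gencert.py`): every own-pattern orbit with `|O| ≥ 6` (fcc and hcp) except the two flexible ones
(C12-924, A12-603), and the P₅ capper pattern, each with one `decide`.
-/

noncomputable section

namespace Summit.Ventures.Crystal3D.Theorems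

open Finset Literature.Geometry.DiscreteGeometry
open scoped RealInnerProductSpace


namespace ConeCert

variable {m : ℕ} (C : ConeCert m)

/-- `√N > 0` for a positive scale `N`. -/
theorem sqrtN_pos (hN : 0 < C.N) : 0 < Real.sqrt C.N := by
  have : (0 : ℝ) < C.N := by exact_mod_cast hN
  exact Real.sqrt_pos.2 this

/-- `⟪s i, own⟫ = 1/2` for an active own contact. -/
theorem inner_s_own (hN : 0 < C.N) (c : Fin C.nO)
    (h : 2 * dotInt (C.slot (C.ownBall c)) (C.ownVec c) = C.N) :
    ⟪C.s (C.ownBall c), (Real.sqrt C.N)⁻¹ • intVec (C.ownVec c)⟫ = 1 / 2 := by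
  have hpos := C.sqrtN_pos hN
  have hsq : Real.sqrt (C.N : ℝ) ^ 2 = C.N := Real.sq_sqrt (by positivity)
  rw [ConeCert.s, real_inner_smul_left, real_inner_smul_right, inner_intVec]
  have h' : (2 : ℝ) * (dotInt (C.slot (C.ownBall c)) (C.ownVec c) : ℝ) = C.N := by exact_mod_cast h
  field_simp
  nlinarith [hsq, h']

/-- `⟪s i, s j⟫ = 1/2` for an active free contact. -/
theorem inner_s_s (hN : 0 < C.N) (c : Fin C.nF)
    (h : 2 * dotInt (C.slot (C.freeA c)) (C.slot (C.freeB c)) = C.N) :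
    ⟪C.s (C.freeA c), C.s (C.freeB c)⟫ = 1 / 2 := by
  have hpos := C.sqrtN_pos hN
  have hsq : Real.sqrt (C.N : ℝ) ^ 2 = C.N := Real.sq_sqrt (by positivity)
  rw [ConeCert.s, ConeCert.s, real_inner_smul_left, real_inner_smul_right, inner_intVec]
  have h' : (2 : ℝ) * (dotInt (C.slot (C.freeA c)) (C.slot (C.freeB c)) : ℝ) = C.N := by
    exact_mod_cast h
  field_simp
  nlinarith [hsq, h']

/-- Regrouping the weighted sum of linearised constraints ball by ball. -/
theorem sum_inner_grad (i₀ : Fin m) (a : Fin 2) (b : Bool) (v : Fin m → (EuclideanSpace ℝ (Fin 3))) :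
    ∑ i : Fin m, ⟪v i, intVec (C.grad i₀ a b i)⟫ =
      (∑ c : Fin C.nO, (C.lamO i₀ a b c : ℝ) * ⟪v (C.ownBall c), intVec (C.ownVec c)⟫) +
      ∑ c : Fin C.nF, (C.lamF i₀ a b c : ℝ) *
        (⟪v (C.freeA c), intVec (C.slot (C.freeB c))⟫ +
          ⟪v (C.freeB c), intVec (C.slot (C.freeA c))⟫) := by
  classical
  have key : ∀ (n : ℕ) (ball : Fin n → Fin m) (vec : Fin n → (Fin 3 → ℤ)) (lam : Fin n → ℕ),
      ∑ i : Fin m, ⟪v i, intVec (∑ c : Fin n, if ball c = i then lam c • vec c else 0)⟫ =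
        ∑ c : Fin n, (lam c : ℝ) * ⟪v (ball c), intVec (vec c)⟫ := by
    intro n ball vec lam
    have : ∀ i : Fin m, ⟪v i, intVec (∑ c : Fin n, if ball c = i then lam c • vec c else 0)⟫ =
        ∑ c : Fin n, if ball c = i then (lam c : ℝ) * ⟪v i, intVec (vec c)⟫ else 0 := by
      intro i
      rw [intVec_sum, inner_sum]
      refine Finset.sum_congr rfl fun c _ => ?_
      split_ifs with h
      · rw [intVec_nsmul, real_inner_smul_right]
      · rw [intVec_zero, inner_zero_right]
    simp_rw [this]
    rw [Finset.sum_comm]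
    refine Finset.sum_congr rfl fun c _ => ?_
    rw [Finset.sum_ite_eq Finset.univ (ball c)]
    simp
  simp only [ConeCert.grad, intVec_add, inner_add_right, Finset.sum_add_distrib]
  rw [key C.nO C.ownBall C.ownVec (C.lamO i₀ a b),
    key C.nF C.freeA (fun c => C.slot (C.freeB c)) (C.lamF i₀ a b),
    key C.nF C.freeB (fun c => C.slot (C.freeA c)) (C.lamF i₀ a b), add_assoc,
    ← Finset.sum_add_distrib]
  congr 1
  refine Finset.sum_congr rfl fun c _ => ?_
  ring

/-- **The bridge: a valid certificate gives the cone-margin hypothesis of `eq_of_coneMargin`**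
(with `s = C.s`, `O = C.ownSet`, `κ = C.kappa`). -/
theorem margin (hV : C.check = true) :
    ∀ v : Fin m → (EuclideanSpace ℝ (Fin 3)), (∀ i, ⟪v i, C.s i⟫ = 0) → ∀ i₀ : Fin m,
      (∃ i, ∃ o ∈ C.ownSet, ⟪C.s i, o⟫ = 1 / 2 ∧ C.kappa * ‖v i₀‖ ≤ ⟪v i, o⟫) ∨
      (∃ i j, i ≠ j ∧ ⟪C.s i, C.s j⟫ = 1 / 2 ∧
        C.kappa * ‖v i₀‖ ≤ ⟪v i, C.s j⟫ + ⟪C.s i, v j⟫) := by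
  classical
  unfold ConeCert.check at hV
  obtain ⟨hN, -, hown, hfree, htan, hcert, hden, -, -⟩ := of_decide_eq_true hV
  intro v hv i₀
  have hsqpos := C.sqrtN_pos hN
  have hcNpos : 0 < (Real.sqrt C.N)⁻¹ := inv_pos.2 hsqpos
  -- tangency in integer form
  have hvI : ∀ i, ⟪v i, intVec (C.slot i)⟫ = 0 := by
    intro i
    have h := hv i
    rw [ConeCert.s, real_inner_smul_right] at h
    rcases mul_eq_zero.1 h with h | h
    · exact absurd h hcNpos.ne'
    · exact h
  -- the tangent frame at i₀ picks a signed direction ±T a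
  obtain ⟨hS0, hT0, hT1, hST0, hST1, hT01⟩ := htan i₀
  obtain ⟨a, b, hdir, hsgn⟩ := exists_dir_of_frame (w := v i₀) (T := fun a => intVec (C.tau i₀ a))
    (intVec_ne_zero hS0) (intVec_ne_zero hT0) (intVec_ne_zero hT1)
    (by rw [inner_intVec]; exact_mod_cast hST0)
    (by rw [inner_intVec]; exact_mod_cast hST1)
    (by rw [inner_intVec]; exact_mod_cast hT01) (hvI i₀)
  set Ta : (EuclideanSpace ℝ (Fin 3)) := intVec (C.tau i₀ a) with hTa
  -- the certificate for (i₀, a, b)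
  obtain ⟨hr, hLam, hid, hkap⟩ := hcert i₀ a b
  set t : ℝ := (sgn b : ℝ) * ⟪v i₀, Ta⟫ with ht
  have ht0 : 0 ≤ t := hsgn
  -- Σ_c λ_c L̃_c(v) = r · t
  have hsum : (∑ c : Fin C.nO, (C.lamO i₀ a b c : ℝ) * ⟪v (C.ownBall c), intVec (C.ownVec c)⟫) +
      ∑ c : Fin C.nF, (C.lamF i₀ a b c : ℝ) *
        (⟪v (C.freeA c), intVec (C.slot (C.freeB c))⟫ +
          ⟪v (C.freeB c), intVec (C.slot (C.freeA c))⟫) = (C.r i₀ a b : ℝ) * t := by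
    rw [← C.sum_inner_grad i₀ a b v]
    have : ∀ i, ⟪v i, intVec (C.grad i₀ a b i)⟫ =
        if i = i₀ then (C.r i₀ a b : ℝ) * t else 0 := by
      intro i
      rw [hid i, intVec_add, inner_add_right, intVec_zsmul, real_inner_smul_right, hvI i, mul_zero,
        zero_add]
      split_ifs with h
      · subst h; rw [intVec_zsmul, real_inner_smul_right, ht, hTa]; push_cast; ring
      · rw [intVec_zero, inner_zero_right]
    simp_rw [this]
    rw [Finset.sum_ite_eq' Finset.univ i₀]; simp
  -- averaging over the disjoint union of the contacts
  have hΛpos : (0 : ℝ) < C.Lam i₀ a b := by exact_mod_cast hLam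
  obtain ⟨c, -, hc⟩ := exists_le_of_sum_eq (Finset.univ : Finset (Fin C.nO ⊕ Fin C.nF))
    (Sum.elim (fun c => (C.lamO i₀ a b c : ℝ)) (fun c => (C.lamF i₀ a b c : ℝ)))
    (Sum.elim (fun c => ⟪v (C.ownBall c), intVec (C.ownVec c)⟫)
      (fun c => ⟪v (C.freeA c), intVec (C.slot (C.freeB c))⟫ +
        ⟪v (C.freeB c), intVec (C.slot (C.freeA c))⟫))
    (Λ := (C.Lam i₀ a b : ℝ)) (y := (C.r i₀ a b : ℝ) * t)
    (by rintro (c | c) - <;> simp)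
    (by rw [Fintype.sum_sum_type]; simp [ConeCert.Lam]) hΛpos
    (by rw [Fintype.sum_sum_type]; simpa using hsum)
  -- the scalar inequality  κ₀ ‖v i₀‖ ≤ (√N)⁻¹ · (r t / Λ)
  have hna : ‖Ta‖ ^ 2 = (dotInt (C.tau i₀ a) (C.tau i₀ a) : ℝ) := by
    rw [← real_inner_self_eq_norm_sq, hTa]; exact inner_intVec _ _
  have hkapR : (C.kapNum : ℝ) ^ 2 * (C.Lam i₀ a b : ℝ) ^ 2 * 2 * C.N ≤
      (C.r i₀ a b : ℝ) ^ 2 * ‖Ta‖ ^ 2 * (C.kapDen : ℝ) ^ 2 := by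
    rw [hna]; exact_mod_cast hkap
  have hdenpos : (0 : ℝ) < C.kapDen := by exact_mod_cast hden
  have hw0 : 0 ≤ ‖v i₀‖ := norm_nonneg _
  have hs2 : (0 : ℝ) < Real.sqrt 2 := Real.sqrt_pos.2 (by norm_num)
  have hsqN : Real.sqrt (C.N : ℝ) ^ 2 = C.N := Real.sq_sqrt (by positivity)
  have htsq : ⟪v i₀, Ta⟫ ^ 2 = t ^ 2 := by
    rw [ht, mul_pow]; cases b <;> simp [sgn]
  -- ‖w‖ ‖T‖ ≤ √2 t
  have hwT : ‖v i₀‖ * ‖Ta‖ ≤ Real.sqrt 2 * t := by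
    have h2 : (‖v i₀‖ * ‖Ta‖) ^ 2 ≤ (Real.sqrt 2 * t) ^ 2 := by
      rw [mul_pow, mul_pow, Real.sq_sqrt (by norm_num), ← htsq]; exact hdir
    exact (pow_le_pow_iff_left₀ (by positivity) (by positivity) two_ne_zero).1 h2
  -- κ₀ Λ √2 √N ≤ r ‖T‖
  have h1 : C.kappa * (C.Lam i₀ a b) * Real.sqrt 2 * Real.sqrt C.N ≤ (C.r i₀ a b : ℝ) * ‖Ta‖ := by
    have hl : 0 ≤ C.kappa * (C.Lam i₀ a b) * Real.sqrt 2 * Real.sqrt C.N := by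
      unfold ConeCert.kappa; positivity
    have hr' : 0 ≤ (C.r i₀ a b : ℝ) * ‖Ta‖ := by positivity
    have h3 : (C.kappa * (C.Lam i₀ a b) * Real.sqrt 2 * Real.sqrt C.N) ^ 2 ≤
        ((C.r i₀ a b : ℝ) * ‖Ta‖) ^ 2 := by
      unfold ConeCert.kappa
      rw [show ((C.kapNum : ℝ) / C.kapDen * (C.Lam i₀ a b) * Real.sqrt 2 * Real.sqrt C.N) ^ 2 =
          (C.kapNum : ℝ) ^ 2 * (C.Lam i₀ a b : ℝ) ^ 2 * 2 * C.N / (C.kapDen : ℝ) ^ 2 by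
          rw [mul_pow, mul_pow, mul_pow, div_pow, Real.sq_sqrt (by norm_num), hsqN]; ring]
      rw [div_le_iff₀ (by positivity), mul_pow]
      exact hkapR
    exact (pow_le_pow_iff_left₀ hl hr' two_ne_zero).1 h3
  -- hence κ₀ Λ √N ‖w‖ ≤ r t
  have hA : C.kappa * (C.Lam i₀ a b) * Real.sqrt C.N * ‖v i₀‖ ≤ (C.r i₀ a b) * t := by
    have h2 := mul_le_mul_of_nonneg_right h1 hw0
    have h3 : (C.r i₀ a b : ℝ) * (‖v i₀‖ * ‖Ta‖) ≤ (C.r i₀ a b) * (Real.sqrt 2 * t) :=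
      mul_le_mul_of_nonneg_left hwT (by positivity)
    have h4 : (C.kappa * (C.Lam i₀ a b) * Real.sqrt C.N * ‖v i₀‖) * Real.sqrt 2 ≤
        ((C.r i₀ a b) * t) * Real.sqrt 2 :=
      calc (C.kappa * (C.Lam i₀ a b) * Real.sqrt C.N * ‖v i₀‖) * Real.sqrt 2
            = C.kappa * (C.Lam i₀ a b) * Real.sqrt 2 * Real.sqrt C.N * ‖v i₀‖ := by ring
        _ ≤ (C.r i₀ a b : ℝ) * ‖Ta‖ * ‖v i₀‖ := h2
        _ = (C.r i₀ a b : ℝ) * (‖v i₀‖ * ‖Ta‖) := by ring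
        _ ≤ (C.r i₀ a b) * (Real.sqrt 2 * t) := h3
        _ = ((C.r i₀ a b) * t) * Real.sqrt 2 := by ring
    exact le_of_mul_le_mul_right h4 hs2
  have hmain : C.kappa * ‖v i₀‖ ≤ (Real.sqrt C.N)⁻¹ * ((C.r i₀ a b : ℝ) * t / C.Lam i₀ a b) := by
    have hpos : (0 : ℝ) < (C.Lam i₀ a b) * Real.sqrt C.N := by positivity
    have h5 : C.kappa * ‖v i₀‖ ≤ ((C.r i₀ a b : ℝ) * t) / ((C.Lam i₀ a b) * Real.sqrt C.N) := by
      rw [le_div_iff₀ hpos]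
      calc C.kappa * ‖v i₀‖ * ((C.Lam i₀ a b) * Real.sqrt C.N)
            = C.kappa * (C.Lam i₀ a b) * Real.sqrt C.N * ‖v i₀‖ := by ring
        _ ≤ (C.r i₀ a b) * t := hA
    calc C.kappa * ‖v i₀‖ ≤ _ := h5
      _ = (Real.sqrt C.N)⁻¹ * ((C.r i₀ a b : ℝ) * t / C.Lam i₀ a b) := by
          field_simp
  -- conclude with the contact `c` found by averaging
  rcases c with c | c
  · left
    refine ⟨C.ownBall c, (Real.sqrt C.N)⁻¹ • intVec (C.ownVec c), ?_, C.inner_s_own hN c (hown c).1,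
      ?_⟩
    · exact Finset.mem_image_of_mem _ (Finset.mem_univ c)
    · rw [real_inner_smul_right]
      simp only [Sum.elim_inl] at hc
      exact hmain.trans (mul_le_mul_of_nonneg_left hc hcNpos.le)
  · right
    refine ⟨C.freeA c, C.freeB c, (hfree c).1, C.inner_s_s hN c (hfree c).2, ?_⟩
    rw [ConeCert.s, ConeCert.s, real_inner_smul_right, real_inner_smul_left,
      real_inner_comm (v (C.freeB c)) (intVec (C.slot (C.freeA c))), ← mul_add]
    simp only [Sum.elim_inr] at hc
    exact hmain.trans (mul_le_mul_of_nonneg_left hc hcNpos.le)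

/-- For a checked certificate the slot vectors `C.s i` are unit vectors. -/
theorem norm_s (hV : C.check = true) (i : Fin m) : ‖C.s i‖ = 1 := by
  unfold ConeCert.check at hV
  obtain ⟨hN, hunit, -⟩ := of_decide_eq_true hV
  have hpos := C.sqrtN_pos hN
  have hsq : ‖intVec (C.slot i)‖ ^ 2 = (C.N : ℝ) := by
    rw [← real_inner_self_eq_norm_sq, inner_intVec]; exact_mod_cast hunit i
  have hn : ‖intVec (C.slot i)‖ = Real.sqrt C.N := by
    rw [← Real.sqrt_sq (norm_nonneg _), hsq]
  rw [ConeCert.s, norm_smul, norm_inv, Real.norm_of_nonneg hpos.le, hn, inv_mul_cancel₀ hpos.ne']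

/-- For a checked certificate `0 < κ₀`. -/
theorem kappa_pos (hV : C.check = true) : 0 < C.kappa := by
  unfold ConeCert.check at hV
  obtain ⟨-, -, -, -, -, -, hden, hnum, -⟩ := of_decide_eq_true hV
  unfold ConeCert.kappa
  have h1 : (0 : ℝ) < C.kapNum := by exact_mod_cast hnum
  have h2 : (0 : ℝ) < C.kapDen := by exact_mod_cast hden
  positivity

/-- For a checked certificate `κ₀ ≤ 3` (the check includes `kapNum ≤ 3·kapDen`). -/
theorem kappa_le_three (hV : C.check = true) : C.kappa ≤ 3 := by
  unfold ConeCert.check at hV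
  obtain ⟨-, -, -, -, -, -, hden, -, hle⟩ := of_decide_eq_true hV
  unfold ConeCert.kappa
  have h2 : (0 : ℝ) < C.kapDen := by exact_mod_cast hden
  have h3 : (C.kapNum : ℝ) ≤ 3 * C.kapDen := by exact_mod_cast hle
  rw [div_le_iff₀ h2]; exact h3

/-- **Exact capping inside the tube (E1, kernel form).**  For a valid certificate `C`: every
admissible completion `x` of the own pattern `C.ownSet` by `m` unit vectors (no overlap with the
active own balls and between the active free pairs suffices) with each `x i` within chord distance
`κ₀/3` of the slot `C.s i` IS the slot configuration. -/
theorem eq_slots (hV : C.check = true) {x : Fin m → (EuclideanSpace ℝ (Fin 3))} (hx : ∀ i, ‖x i‖ = 1)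
    (hxo : ∀ i, ∀ o ∈ C.ownSet, ⟪C.s i, o⟫ = 1 / 2 → ⟪x i, o⟫ ≤ 1 / 2)
    (hxx : ∀ i j, i ≠ j → ⟪C.s i, C.s j⟫ = 1 / 2 → ⟪x i, x j⟫ ≤ 1 / 2)
    (hclose : ∀ i, ‖x i - C.s i‖ < C.kappa / 3) : x = C.s :=
  eq_of_coneMargin (C.kappa_pos hV) (C.kappa_le_three hV) (C.norm_s hV) hx hxo hxx (C.margin hV)
    hclose

/-- The same with the sharper tube radius `3κ₀/5`, for certificates with `κ₀ ≤ 1`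
(`C.kapNum ≤ C.kapDen`, one more `decide`; every certificate of lit g11 has `κ₀ < 1/2`). -/
theorem eq_slots_sharp (hV : C.check = true) (h1 : C.kapNum ≤ C.kapDen) {x : Fin m → (EuclideanSpace ℝ (Fin 3))}
    (hx : ∀ i, ‖x i‖ = 1)
    (hxo : ∀ i, ∀ o ∈ C.ownSet, ⟪C.s i, o⟫ = 1 / 2 → ⟪x i, o⟫ ≤ 1 / 2)
    (hxx : ∀ i j, i ≠ j → ⟪C.s i, C.s j⟫ = 1 / 2 → ⟪x i, x j⟫ ≤ 1 / 2)
    (hclose : ∀ i, ‖x i - C.s i‖ < 3 * C.kappa / 5) : x = C.s := by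
  have hκ1 : C.kappa ≤ 1 := by
    unfold ConeCert.check at hV
    obtain ⟨-, -, -, -, -, -, hden, -, -⟩ := of_decide_eq_true hV
    unfold ConeCert.kappa
    have h2 : (0 : ℝ) < C.kapDen := by exact_mod_cast hden
    have h3 : (C.kapNum : ℝ) ≤ C.kapDen := by exact_mod_cast h1
    rw [div_le_iff₀ h2, one_mul]; exact h3
  exact eq_of_coneMargin_sharp (C.kappa_pos hV) hκ1 (C.norm_s hV) hx hxo hxx (C.margin hV) hclose

/-! ### The same in the distance vocabulary of `IsKissingAround` / `ExactOnly` -/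

/-- For a checked certificate the own vectors are unit vectors. -/
theorem norm_own (hV : C.check = true) : ∀ o ∈ C.ownSet, ‖o‖ = 1 := by
  unfold ConeCert.check at hV
  obtain ⟨hN, -, hown, -⟩ := of_decide_eq_true hV
  intro o ho
  obtain ⟨c, -, rfl⟩ := Finset.mem_image.1 ho
  have hpos := C.sqrtN_pos hN
  have hsq : ‖intVec (C.ownVec c)‖ ^ 2 = (C.N : ℝ) := by
    rw [← real_inner_self_eq_norm_sq, inner_intVec]; exact_mod_cast (hown c).2
  have hn : ‖intVec (C.ownVec c)‖ = Real.sqrt C.N := by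
    rw [← Real.sqrt_sq (norm_nonneg _), hsq]
  rw [norm_smul, norm_inv, Real.norm_of_nonneg hpos.le, hn, inv_mul_cancel₀ hpos.ne']

/-- The slots lie in the pattern scaled from any integer set containing the slot vectors
(e.g. `fccInt`, `hcpInt`; membership is one `decide`). -/
theorem s_mem_scaledPattern {S : Finset (Fin 3 → ℤ)} (h : ∀ i, C.slot i ∈ S) (i : Fin m) :
    C.s i ∈ scaledPattern S C.N :=
  Finset.mem_image.2 ⟨C.slot i, h i, rfl⟩

/-- The active own vectors lie in the pattern scaled from any integer set containing them. -/
theorem ownSet_subset_scaledPattern {S : Finset (Fin 3 → ℤ)} (h : ∀ c, C.ownVec c ∈ S) :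
    C.ownSet ⊆ scaledPattern S C.N := by
  intro o ho
  obtain ⟨c, -, rfl⟩ := Finset.mem_image.1 ho
  exact Finset.mem_image.2 ⟨C.ownVec c, h c, rfl⟩

/-- Unit vectors at distance `≥ 1` have inner product `≤ 1/2`. -/
theorem inner_le_half_of_one_le_dist {p q : (EuclideanSpace ℝ (Fin 3))} (hp : ‖p‖ = 1) (hq : ‖q‖ = 1) (h : 1 ≤ dist p q) :
    ⟪p, q⟫ ≤ 1 / 2 := by
  have h1 : 1 ≤ ‖p - q‖ ^ 2 := by
    rw [← dist_eq_norm]; nlinarith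
  have h2 : ‖p - q‖ ^ 2 = ‖p‖ ^ 2 - 2 * ⟪p, q⟫ + ‖q‖ ^ 2 := norm_sub_sq_real p q
  rw [hp, hq] at h2
  linarith

/-- **`eq_slots` in distance form**: unit vectors `x i` keeping distance `≥ 1` from the active own
balls and from each other, each within distance `κ₀/3` of its slot, are the slots. -/
theorem eq_slots_dist (hV : C.check = true) {x : Fin m → (EuclideanSpace ℝ (Fin 3))} (hx : ∀ i, ‖x i‖ = 1)
    (hxo : ∀ i, ∀ o ∈ C.ownSet, 1 ≤ dist (x i) o) (hxx : ∀ i j, i ≠ j → 1 ≤ dist (x i) (x j))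
    (hclose : ∀ i, dist (x i) (C.s i) < C.kappa / 3) : x = C.s :=
  C.eq_slots hV hx
    (fun i o ho _ => inner_le_half_of_one_le_dist (hx i) (C.norm_own hV o ho) (hxo i o ho))
    (fun i j hij _ => inner_le_half_of_one_le_dist (hx i) (hx j) (hxx i j hij))
    (fun i => by rw [← dist_eq_norm]; exact hclose i)

/-- Distance form with the sharper radius `3κ₀/5` (`kapNum ≤ kapDen`). -/
theorem eq_slots_dist_sharp (hV : C.check = true) (h1 : C.kapNum ≤ C.kapDen) {x : Fin m → (EuclideanSpace ℝ (Fin 3))}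
    (hx : ∀ i, ‖x i‖ = 1) (hxo : ∀ i, ∀ o ∈ C.ownSet, 1 ≤ dist (x i) o)
    (hxx : ∀ i j, i ≠ j → 1 ≤ dist (x i) (x j))
    (hclose : ∀ i, dist (x i) (C.s i) < 3 * C.kappa / 5) : x = C.s :=
  C.eq_slots_sharp hV h1 hx
    (fun i o ho _ => inner_le_half_of_one_le_dist (hx i) (C.norm_own hV o ho) (hxo i o ho))
    (fun i j hij _ => inner_le_half_of_one_le_dist (hx i) (hx j) (hxx i j hij))
    (fun i => by rw [← dist_eq_norm]; exact hclose i)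

end ConeCert

end Summit.Ventures.Crystal3D.Theorems

end
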